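import Summits.KontsevichZagierPeriods.KontsevichZagierPeriods.Theses.SymplecticScissors

/-!
# Route SymplecticScissors — `CompilerModusPonens` (item stmt-KontsevichZagierPeriods-14934)

Glue edge of the route cone: `PlanarCompiler → RealOnePeriodRelations → PlanarK0Injective`.

The crux `PlanarCompiler` (stmt-KontsevichZagierPeriods-10058) is, by definition, the implication
whose antecedent is the body of `RealOnePeriodRelations` (stmt-KontsevichZagierPeriods-10042) and
whose consequent is the body of `PlanarK0Injective` (stmt-KontsevichZagierPeriods-9847), both
inlined verbatim in the route file. Hence the edge is modus ponens up to unfolding: after unfolding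
the three definitions the goal is `(R → K) → R → K`, closed by `fun hC hR => hC hR`.
Its only purpose is to NAME the edge `PlanarCompiler ∧ RealOnePeriodRelations ⟹ PlanarK0Injective`
for the cone of `closes`. No named facts, no new definitions.
-/

namespace Summit.KontsevichZagierPeriods.SymplecticScissors

/-- **CompilerModusPonens** (route SymplecticScissors, item stmt-KontsevichZagierPeriods-14934):
`PlanarCompiler → RealOnePeriodRelations → PlanarK0Injective`. Since `PlanarCompiler` unfolds to
`(body of RealOnePeriodRelations) → (body of PlanarK0Injective)` verbatim, this is modus ponens. -/
theorem compilerModusPonens_proof :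
    Summit.KontsevichZagierPeriods.KontsevichZagierPeriods.Theses.SymplecticScissors.CompilerModusPonens := by
  unfold Summit.KontsevichZagierPeriods.KontsevichZagierPeriods.Theses.SymplecticScissors.CompilerModusPonens
    Summit.KontsevichZagierPeriods.KontsevichZagierPeriods.Theses.SymplecticScissors.PlanarCompiler
    Summit.KontsevichZagierPeriods.KontsevichZagierPeriods.Theses.SymplecticScissors.RealOnePeriodRelations
    Summit.KontsevichZagierPeriods.KontsevichZagierPeriods.Theses.SymplecticScissors.PlanarK0Injective
  intro hC hR
  exact hC hR

end Summit.KontsevichZagierPeriods.SymplecticScissors
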